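import Literature.AnabelianGeometry.EtaleTheta.Discharge.Sec3TemperedFrobenioidRigidOverBaseOfDataRigid
import HarnessLib

/-!
# [EtTh] Def. 3.6 tempered Frobenioids: `RigidOverBase` from `DivisorDataRigid` and the RATIO-FORM extraction Prop
# `SelfEquivInducesDataAutRatio` — the repair «HIND-RATIO» of the displayed [FrdI]-shape binder (companion of ★ p527197)

S. Mochizuki, *The étale theta function …*, Publ. RIMS **45** (2009), Def. 3.6 pp. 302–303 (PDF pp. 76–77): the tempered Frobenioid is the
model Frobenioid of the data `(D, Φ, B, B → Φ^gp)` [cite: MochizukiEtTh2009, Def 3.6 p.303 (PDF p.77)]; S. Mochizuki, *The geometry of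
Frobenioids I* (2008), Thm. 5.2 (i)/(ii) p. 100–101 (a morphism of the model Frobenioid IS `(deg_Fr, Base, Div, u)`; «there is a natural
isomorphism … between the functor `O^×(−)` on `D` associated to the Frobenioid `C^birat` … and the functor `B`» — `B` is the monoid of
BIRATIONAL units), Cor. 4.10 p. 90 (the birationalization is category-theoretic) [cite: MochizukiFrdI2008, Thm. 5.2 p.100]; consumer locus
[IUTchI] Cor. 5.3 (iv) proof p. 145 l. 1–2 («induces … the identity on the rational function and divisor monoids of `ℱ̲_v̲`»).

abc-iut cell; PROPOSAL-TEXT authored by abc-iut-L5-t1 gen 13 on abc-iut-L5-lead RULINGS #159 (2) «HIND-RATIO», L2 CUSTODY (files only on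
abc-iut-L2-lead's word; RQ7 reader abc-iut-L2-t12).  CONTEXT.  abc-iut-L2-t12's ★ p527197 displays `SelfEquivInducesDataAut C`, whose UNIT
clause `u_{Ψ φ} = η^* b(u_φ)` for EVERY arrow is the ENTRY-WISE reading of p. 145 l. 1–2; together with `DivisorDataRigid C` it is
UNSATISFIABLE at every carrier with a non-trivial divisor-free base-compatible unit (abc-iut-L5-t1 «HIND-ENTRYWISE-VACUITY»,
`Cor53ivTelescopeBinderVacuity`, one call of abc-iut-L1-t7's unit twist ★ `ModelFrobenioid.exists_unitTwist_selfEquivalence`).  Print's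
hypothesis is about BIRATIONAL units — ratios `u_f / u_g` of PARALLEL LINEAR arrows over one base arrow ([FrdI] Cor. 4.10, Thm. 5.2 (ii)),
which the unit twist does not move.  THIS FILE (statements-first; ONE new displayed Prop, two verbatim re-derivations, one comparison):

* **`TemperedFrobenioid.SelfEquivInducesDataAutRatio C`** — the REPAIRED extraction Prop: as `SelfEquivInducesDataAut` but with the unit
  clause in RATIO form, «for parallel LINEAR `f g : X → Y` over the same base arrow, `u_{Ψ f} · η^* b(u_g) = u_{Ψ g} · η^* b(u_f)`»
  (FACT-SHAPE ≙ [FrdI] Thm 4.2/4.9 (divisors) + Cor 4.10 / Thm 5.2 (ii) (birational units) category-theoreticity; not proved here);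
* `selfEquivInducesDataAutRatio_of_selfEquivInducesDataAut` — the repair is a WEAKENING of the displayed Prop (entry-wise ⇒ ratio);
* **`hrat_of_divisorDataRigidRatio`** — L5's print-strength law `hrat` (abc-iut-L5-t4 ★ p516053, binder VERBATIM) from
  `SelfEquivInducesDataAutRatio ∧ DivisorDataRigid` (`b = id` turns the ratio clause into `hratio` on the nose);
* **`rigidOverBase_of_divisorDataRigidRatio`** — `CatIsomorphism.RigidOverBase C.baseFunctorOfCategory` modulo the REPAIRED pair and the
  [FrdI] Thm 5.2 standing hypotheses BY NAME (one call of ★ p516053 §3).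

HONEST LABELS: theorem-form only; `SelfEquivInducesDataAutRatio` and `DivisorDataRigid` stay DISPLAYED (typed ≠ proved); the R1444 flag on
`DivisorDataRigid` at DESIGN carriers with a left group action stands unchanged; the ratio repair removes the entry-wise vacuity and nothing
else; no `instance`, no notation; nothing of [IUTchI]/[EtTh] is asserted; no side taken on [IUTchIII] Cor. 3.12; nothing here asserts abc
proved or refuted.
-/

noncomputable section

namespace Literature.AnabelianGeometry.EtaleTheta

open CategoryTheory Opposite Literature.AlgebraicGeometry.Frobenioids Literature.IUT.HodgeTheaters

namespace TemperedFrobenioid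

universe u₀ v₀ u v w

variable {D₀ : Type u₀} [Category.{v₀} D₀] {V : FrdIMonoidStub.{w}}
  {T : RealifiedDivisorMonoids (D₀ := D₀) V} {D : Type u} [Category.{v} D]
  {VD : FrdICatStub.{u, v, w} D} (C : TemperedFrobenioid T D VD)

/-! ## §1 The repaired extraction Prop: unit clause on BIRATIONAL units (ratios of parallel linear arrows) -/

/-- **«Every self-equivalence of the tempered Frobenioid over the identity of `D` arises, up to a base identification `η`, from a data
automorphism» — RATIO FORM** (the [FrdI] category-theoreticity SHAPE, DISPLAYED BY NAME, not proved here): for every self-equivalence `Ψ` of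
`C.category` with `Ψ ⋙ Base ≅ Base` there are `η : Ψ ⋙ Base ≅ Base` and a data automorphism `τ = (a, b)` with `Div(Ψ φ) = η_X^* (a (Div φ))`
for every arrow `φ` (Thm 4.2 / 4.9: the divisor monoid is category-theoretic) and, for every pair of PARALLEL LINEAR arrows `f, g : X → Y`
over the same base arrow, `u_{Ψ f} · η_X^* (b (u_g)) = u_{Ψ g} · η_X^* (b (u_f))` — i.e. `Ψ` carries the BIRATIONAL unit `u_f / u_g ∈ B(A)`
to `η_X^* b (u_f / u_g)` (Cor 4.10 / Thm 5.2 (ii): `B ≅ O^×((−)^birat)` is category-theoretic).  The entry `u_φ` of a single arrow is NOT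
category-theoretic (unit twists move it), which is why the entry-wise form `SelfEquivInducesDataAut` is replaced by this one.
[cite: MochizukiFrdI2008, Thm. 5.2 p.100] -/
def SelfEquivInducesDataAutRatio : Prop :=
  ∀ Ψ : C.category ≌ C.category, Nonempty (Ψ.functor ⋙ C.baseFunctorOfCategory ≅ C.baseFunctorOfCategory) →
    ∃ η : Ψ.functor ⋙ C.baseFunctorOfCategory ≅ C.baseFunctorOfCategory, ∃ τ : C.DataAut,
      (∀ ⦃X Y : C.category⦄ (φ : X ⟶ Y),
          ModelFrobenioid.div (Ψ.functor.map φ) =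
            pull C.divisorMonoid (η.hom.app X : (Ψ.functor.obj X).base ⟶ X.base) (τ.a (op X.base) (ModelFrobenioid.div φ))) ∧
      (∀ ⦃X Y : C.category⦄ (f g : X ⟶ Y), ModelFrobenioid.degFr f = 1 → ModelFrobenioid.degFr g = 1 →
          ModelFrobenioid.baseMap f = ModelFrobenioid.baseMap g →
          ModelFrobenioid.unit (Ψ.functor.map f) *
              pull C.ratFnFunctor (A := X.base) (B := (Ψ.functor.obj X).base) (η.hom.app X) (τ.b (op X.base) (ModelFrobenioid.unit g)) =
            ModelFrobenioid.unit (Ψ.functor.map g) *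
              pull C.ratFnFunctor (A := X.base) (B := (Ψ.functor.obj X).base) (η.hom.app X) (τ.b (op X.base) (ModelFrobenioid.unit f)))

/-- The repair is a WEAKENING: the entry-wise extraction Prop `SelfEquivInducesDataAut` (★ p527197) implies the ratio form (multiply the two
entry-wise identities crosswise). [cite: MochizukiFrdI2008, Thm. 5.2 p.100] -/
theorem selfEquivInducesDataAutRatio_of_selfEquivInducesDataAut (hind : C.SelfEquivInducesDataAut) :
    C.SelfEquivInducesDataAutRatio := by
  intro Ψ hΨ
  obtain ⟨η, τ, hdiv, hunit⟩ := hind Ψ hΨ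
  refine ⟨η, τ, hdiv, fun X Y f g _ _ _ => ?_⟩
  rw [hunit f, hunit g, mul_comm]

/-! ## §2 L5's print-strength law `hrat` and `RigidOverBase` from the REPAIRED pair -/

/-- **L5's print-strength LAW `hrat` (abc-iut-L5-t4 ★ p516053 `Cor53.tempered_rigidOverBase_of_divRatioRigid`, binder VERBATIM) from the
REPAIRED pair** `SelfEquivInducesDataAutRatio ∧ DivisorDataRigid`: the data automorphism `(a, b)` is trivial (`DivisorDataRigid`), so the
divisor clause is `hdiv` and the ratio clause is `hratio` on the nose. [cite: MochizukiEtTh2009, Def 3.6 p.303 (PDF p.77)] -/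
theorem hrat_of_divisorDataRigidRatio (hind : C.SelfEquivInducesDataAutRatio) (hrig : C.DivisorDataRigid) :
    ∀ Ψ : C.category ≌ C.category,
      Nonempty (Ψ.functor ⋙ C.baseFunctorOfCategory ≅ C.baseFunctorOfCategory) →
      ∃ η : Ψ.functor ⋙ C.baseFunctorOfCategory ≅ C.baseFunctorOfCategory,
        (∀ ⦃X Y : C.category⦄ (φ : X ⟶ Y),
            ModelFrobenioid.div (Ψ.functor.map φ) =
              pull C.divisorMonoid (η.hom.app X : (Ψ.functor.obj X).base ⟶ X.base) (ModelFrobenioid.div φ)) ∧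
        (∀ ⦃X Y : C.category⦄ (f g : X ⟶ Y), ModelFrobenioid.degFr f = 1 →
            ModelFrobenioid.degFr g = 1 → ModelFrobenioid.baseMap f = ModelFrobenioid.baseMap g →
            ModelFrobenioid.unit (Ψ.functor.map f) *
                pull C.ratFnFunctor (A := X.base) (B := (Ψ.functor.obj X).base) (η.hom.app X) (ModelFrobenioid.unit g) =
              ModelFrobenioid.unit (Ψ.functor.map g) *
                pull C.ratFnFunctor (A := X.base) (B := (Ψ.functor.obj X).base) (η.hom.app X)
                  (ModelFrobenioid.unit f)) := by
  intro Ψ hΨ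
  obtain ⟨η, τ, hdiv, hratio⟩ := hind Ψ hΨ
  obtain ⟨ha, hb⟩ := hrig τ
  refine ⟨η, fun X Y φ => ?_, fun X Y f g hf hg hfg => ?_⟩
  · rw [hdiv φ, ha]
  · have h := hratio f g hf hg hfg
    rw [hb, hb] at h
    exact h

/-- **`RigidOverBase (C.category → D)` — [IUTchI] Cor 5.3 (iv) injectivity content AS TYPED by abc-iut-L5 — at an [EtTh] Def. 3.6 tempered
Frobenioid, MODULO the REPAIRED displayed pair {`SelfEquivInducesDataAutRatio` ([FrdI] shape, ratio form), `DivisorDataRigid` ([EtTh])} and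
the [FrdI] Thm. 5.2 standing hypotheses BY NAME** (one call through abc-iut-L5-t4's ★ p516053 §3).  R1444 flag on `DivisorDataRigid` at
design carriers unchanged. [cite: MochizukiEtTh2009, Def 3.6 p.303 (PDF p.77)] -/
theorem rigidOverBase_of_divisorDataRigidRatio
    (h : ModelFrobenioid.Hypotheses C.divisorMonoid C.ratFnFunctor) (hsl : IsSlim D) (hfs : IsOfFSMFFType D)
    (hnd : IsNonDilatingOn C.divisorMonoid) (hz : ¬ ModelFrobenioid.IsZeroMonoid C.divisorMonoid)
    (hind : C.SelfEquivInducesDataAutRatio) (hrig : C.DivisorDataRigid) :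
    CatIsomorphism.RigidOverBase C.baseFunctorOfCategory :=
  Cor53.tempered_rigidOverBase_of_divRatioRigid C h hsl hfs hnd hz (C.hrat_of_divisorDataRigidRatio hind hrig)

end TemperedFrobenioid

end Literature.AnabelianGeometry.EtaleTheta

end
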